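import Literature.IUT.LogVolume.FakeAdeleIndex
import Mathlib.NumberTheory.NumberField.InfinitePlace.Basic
import HarnessLib

/-!
# [IUTchIV] Definition 1.9: `ℝ`-arithmetic divisors on a number field, the degree maps `deg_F`,
# `deg`, and the normalized `E`-degree `deg_E`

Mochizuki, *Inter-universal Teichmüller theory IV*, §1, Definition 1.9, kurims pp. 21–22, read on the
page: "Let `F` be a number field … whose set of valuations we denote by `𝕍(F)`. Thus, `𝕍(F)` decomposes as
a disjoint union `𝕍(F) = 𝕍(F)^non ∪ 𝕍(F)^arc` … if `v ∈ 𝕍(F)^non`, then we shall write `e_v` for the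
ramification index of `F_v` over `ℚ_{p_v}`, `f_v` for the residue field degree …, and `q_v` for the
cardinality of the residue field of `F_v`.
(i) An [`ℝ`-]arithmetic divisor `𝔞` on `F` is defined to be a finite formal sum `Σ_{v ∈ 𝕍(F)} c_v·v` — where
`c_v ∈ ℝ` …. Here, we shall refer to the set `Supp(𝔞)` of `v ∈ 𝕍(F)` such that `c_v ≠ 0` as the support
of `𝔞`; if all of the `c_v` are `≥ 0`, then we shall say that the arithmetic divisor is effective. Thus,
the [`ℝ`-]arithmetic divisors on `F` naturally form a group `ADiv_ℝ(F)`. The assignment `𝕍(F)^non ∋ v ↦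
log(q_v)`; `𝕍(F)^arc ∋ v ↦ 1` determines a homomorphism `deg_F : ADiv_ℝ(F) → ℝ` which we shall refer to
as the degree map. If `𝔞 ∈ ADiv_ℝ(F)`, then we shall refer to `deg(𝔞) := (1/[F:ℚ])·deg_F(𝔞)` as the
normalized degree of `𝔞`. Thus, for any finite extension `K` of `F`, we have `deg(𝔞|_K) = deg(𝔞)` …
(ii) Let `v_ℚ ∈ 𝕍_ℚ = 𝕍(ℚ)`, `E ⊆ 𝕍(F)` a nonempty set of elements lying over `v_ℚ`. If `𝔞 = Σ c_v·v`,
then we shall write `𝔞_E := Σ_{v ∈ E} c_v·v`; `deg_E(𝔞) := deg_F(𝔞_E) / (Σ_{v∈E} [F_v : ℚ_{v_ℚ}])` for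
the portion of `𝔞` supported in `E` and the 'normalized `E`-degree' of `𝔞`, respectively."

Rendering (Mathlib + the tree): `𝕍(F)^arc = NumberField.InfinitePlace F`, `𝕍(F)^non =
IsDedekindDomain.HeightOneSpectrum (𝓞 F)` (as in `ArakelovDivisors.lean` / `FakeAdeleIndex.lean` of
this directory, whose `logNorm F v = log q_v` and `localDegree F v = e_v·f_v = [F_v : ℚ_{p_v}]` are
REUSED); `Place F := 𝕍(F)^arc ⊕ 𝕍(F)^non`; `ADiv_ℝ(F) = Place F →₀ ℝ` (finite formal sums; an additive
group, indeed an `ℝ`-module); `[F_v : ℚ_{v_ℚ}]` at an archimedean `v` (`ℚ_{v_ℚ} = ℝ`) is `v.mult ∈ {1, 2}`.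
PROVED bookkeeping: `degF` is additive/linear, its values on single places, `Σ_{v | ∞} [F_v:ℝ] = [F:ℚ]`
and `Σ_{v | p} [F_v:ℚ_p] = [F:ℚ]` (so `deg_E = deg` when `E` is ALL places over `v_ℚ`:
`degE_placesOverInf_eq_ndeg`, `degE_placesOver_eq_ndeg`), effectivity ⇒ `deg ≥ 0`.
[cite: Mochizuki2012, IUTchIV Def. 1.9 (i)(ii) pp. 21–22]
Deliberately NOT here (`TODO(general form)`, companion file): the pull-back `𝔞|_K` to a finite extension
and the two invariance statements `deg(𝔞|_K) = deg(𝔞)`, `deg_{E|_K}(𝔞|_K) = deg_E(𝔞)` (they need the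
relative identities `Σ_{w|v} e_{w|v} f_{w|v} = [K:F]`, `Σ_{w|v} [K_w:F_v] = [K:F]`); the specific divisors
`𝔮`, `𝔣`, `𝔡` of Thm. 1.10 (abc-iut-S3's `Theorem110Data.lean` carries their degrees as data).
-/

noncomputable section

namespace Literature.IUT.LogVolume

open NumberField IsDedekindDomain Finset

variable (F : Type*) [Field F] [NumberField F]

/-! ### (i) places, `ℝ`-arithmetic divisors, support, effectivity -/

/-- `𝕍(F) = 𝕍(F)^arc ∪ 𝕍(F)^non` (disjoint union): the places of the number field `F`.
[cite: Mochizuki2012, IUTchIV Def. 1.9 p. 21] -/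
abbrev Place : Type _ := InfinitePlace F ⊕ HeightOneSpectrum (𝓞 F)

/-- `ADiv_ℝ(F)`: the [`ℝ`-]arithmetic divisors on `F` — finite formal sums `Σ_{v ∈ 𝕍(F)} c_v·v`, `c_v ∈ ℝ`
("naturally form a group"; here an `ℝ`-module of finitely supported functions).
[cite: Mochizuki2012, IUTchIV Def. 1.9 (i) p. 21] -/
abbrev ADivisor : Type _ := Place F →₀ ℝ

namespace ADivisor

variable {F}

/-- `Supp(𝔞)`: the set of `v ∈ 𝕍(F)` with `c_v ≠ 0`. [cite: Mochizuki2012, IUTchIV Def. 1.9 (i) p. 21] -/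
abbrev supp (a : ADivisor F) : Finset (Place F) := a.support

omit [NumberField F] in
/-- `v ∈ Supp(𝔞) ↔ c_v ≠ 0`. [cite: Mochizuki2012, IUTchIV Def. 1.9 (i) p. 21] -/
theorem mem_supp_iff (a : ADivisor F) (v : Place F) : v ∈ a.supp ↔ a v ≠ 0 := Finsupp.mem_support_iff

/-- `𝔞` is effective if all `c_v ≥ 0`. [cite: Mochizuki2012, IUTchIV Def. 1.9 (i) p. 21] -/
def IsEffective (a : ADivisor F) : Prop := ∀ v, 0 ≤ a v

/-- The divisor `c·v` supported at one place. [cite: Mochizuki2012, IUTchIV Def. 1.9 (i) p. 21] -/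
abbrev of (v : Place F) (c : ℝ) : ADivisor F := Finsupp.single v c

end ADivisor

/-! ### (i) the degree map `deg_F` and the normalized degree `deg` -/

/-- The weights of the degree map: `𝕍(F)^non ∋ v ↦ log(q_v)`, `𝕍(F)^arc ∋ v ↦ 1`.
[cite: Mochizuki2012, IUTchIV Def. 1.9 (i) p. 21] -/
def degWeight : Place F → ℝ := Sum.elim (fun _ => 1) (fun v => logNorm F v)

/-- `deg_F(v) = 1` for archimedean `v`. [cite: Mochizuki2012, IUTchIV Def. 1.9 (i) p. 21] -/
@[simp] theorem degWeight_inl (v : InfinitePlace F) : degWeight F (Sum.inl v) = 1 := rfl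

/-- `deg_F(v) = log(q_v)` for nonarchimedean `v`. [cite: Mochizuki2012, IUTchIV Def. 1.9 (i) p. 21] -/
@[simp] theorem degWeight_inr (v : HeightOneSpectrum (𝓞 F)) : degWeight F (Sum.inr v) = logNorm F v := rfl

/-- The weights are positive (`q_v ≥ 2`). [cite: Mochizuki2012, IUTchIV Def. 1.9 (i) p. 21] -/
theorem degWeight_pos (v : Place F) : 0 < degWeight F v := by
  rcases v with v | v
  · exact one_pos
  · exact logNorm_pos F v

/-- **The degree map** `deg_F : ADiv_ℝ(F) → ℝ`, `Σ c_v·v ↦ Σ_{v ∤ ∞} c_v·log(q_v) + Σ_{v | ∞} c_v` — a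
homomorphism (here `ℝ`-linear). [cite: Mochizuki2012, IUTchIV Def. 1.9 (i) p. 21] -/
def degF : ADivisor F →ₗ[ℝ] ℝ := Finsupp.linearCombination ℝ (degWeight F)

/-- `deg_F(𝔞) = Σ_{v ∈ Supp 𝔞} c_v · deg_F(v)`. [cite: Mochizuki2012, IUTchIV Def. 1.9 (i) p. 21] -/
theorem degF_apply (a : ADivisor F) : degF F a = a.sum (fun v c => c * degWeight F v) := by
  simp [degF, Finsupp.linearCombination_apply, Finsupp.sum, smul_eq_mul]

/-- `deg_F(c·v) = c` for archimedean `v`. [cite: Mochizuki2012, IUTchIV Def. 1.9 (i) p. 21] -/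
theorem degF_of_inl (v : InfinitePlace F) (c : ℝ) : degF F (ADivisor.of (Sum.inl v) c) = c := by
  simp [degF, Finsupp.linearCombination_single]

/-- `deg_F(c·v) = c·log(q_v)` for nonarchimedean `v`. [cite: Mochizuki2012, IUTchIV Def. 1.9 (i) p. 21] -/
theorem degF_of_inr (v : HeightOneSpectrum (𝓞 F)) (c : ℝ) :
    degF F (ADivisor.of (Sum.inr v) c) = c * logNorm F v := by
  simp [degF, Finsupp.linearCombination_single, smul_eq_mul]

/-- An effective divisor has nonnegative degree. [cite: Mochizuki2012, IUTchIV Def. 1.9 (i) p. 21] -/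
theorem degF_nonneg {a : ADivisor F} (ha : a.IsEffective) : 0 ≤ degF F a := by
  rw [degF_apply]
  exact Finset.sum_nonneg fun v _ => mul_nonneg (ha v) (degWeight_pos F v).le

/-- **The normalized degree** `deg(𝔞) := deg_F(𝔞)/[F:ℚ]`. [cite: Mochizuki2012, IUTchIV Def. 1.9 (i) p. 21] -/
def ndeg : ADivisor F →ₗ[ℝ] ℝ := (Module.finrank ℚ F : ℝ)⁻¹ • degF F

/-- `deg(𝔞) = deg_F(𝔞)/[F:ℚ]`. [cite: Mochizuki2012, IUTchIV Def. 1.9 (i) p. 21] -/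
theorem ndeg_apply (a : ADivisor F) : ndeg F a = degF F a / Module.finrank ℚ F := by
  simp [ndeg, div_eq_inv_mul]

/-- An effective divisor has nonnegative normalized degree. [cite: Mochizuki2012, IUTchIV Def. 1.9 (i) p. 21] -/
theorem ndeg_nonneg {a : ADivisor F} (ha : a.IsEffective) : 0 ≤ ndeg F a := by
  rw [ndeg_apply]
  exact div_nonneg (degF_nonneg F ha) (Nat.cast_nonneg _)

/-! ### The local degrees `[F_v : ℚ_{v_ℚ}]` -/

/-- `[F_v : ℚ_{v_ℚ}]`: at a nonarchimedean `v` the local degree `e_v·f_v = [F_v : ℚ_{p_v}]`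
(`FakeAdeleIndex.localDegree`); at an archimedean `v` (`ℚ_{v_ℚ} = ℝ`) it is `[F_v : ℝ] = v.mult ∈ {1,2}`.
[cite: Mochizuki2012, IUTchIV Def. 1.9 p. 21] -/
def placeDegree : Place F → ℕ := Sum.elim (fun v => v.mult) (fun v => localDegree F v)

/-- `[F_v : ℚ_{v_ℚ}] ≥ 1`. [cite: Mochizuki2012, IUTchIV Def. 1.9 p. 21] -/
theorem placeDegree_pos (v : Place F) : 0 < placeDegree F v := by
  rcases v with v | v
  · exact InfinitePlace.mult_pos
  · exact localDegree_pos F v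

/-- `Σ_{v | ∞} [F_v : ℝ] = [F : ℚ]`. [cite: Mochizuki2012, IUTchIV Def. 1.9 p. 21] -/
theorem sum_placeDegree_inl : ∑ v : InfinitePlace F, placeDegree F (Sum.inl v) = Module.finrank ℚ F :=
  InfinitePlace.sum_mult_eq

/-- `Σ_{v | p} [F_v : ℚ_p] = [F : ℚ]`. [cite: Mochizuki2012, IUTchIV Def. 1.9 p. 21] -/
theorem sum_placeDegree_inr (p : ℕ) [Fact p.Prime] :
    ∑ v ∈ placesOver F p, placeDegree F (Sum.inr v) = Module.finrank ℚ F :=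
  sum_localDegree F p

/-! ### (ii) `𝔞_E` and the normalized `E`-degree -/

namespace ADivisor

variable {F}

open scoped Classical in
/-- `𝔞_E := Σ_{v ∈ E} c_v·v`, the portion of `𝔞` supported in `E`.
[cite: Mochizuki2012, IUTchIV Def. 1.9 (ii) p. 22] -/
def restrictTo (E : Finset (Place F)) (a : ADivisor F) : ADivisor F := a.filter (· ∈ E)

omit [NumberField F] in
open scoped Classical in
/-- Coefficients of `𝔞_E`. [cite: Mochizuki2012, IUTchIV Def. 1.9 (ii) p. 22] -/
theorem restrictTo_apply (E : Finset (Place F)) (a : ADivisor F) (v : Place F) :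
    a.restrictTo E v = if v ∈ E then a v else 0 := by
  rw [restrictTo, Finsupp.filter_apply]

omit [NumberField F] in
open scoped Classical in
/-- `𝔞 ↦ 𝔞_E` is additive. [cite: Mochizuki2012, IUTchIV Def. 1.9 (ii) p. 22] -/
theorem restrictTo_add (E : Finset (Place F)) (a b : ADivisor F) :
    (a + b).restrictTo E = a.restrictTo E + b.restrictTo E := by
  ext v; simp only [restrictTo_apply, Finsupp.add_apply]; split_ifs <;> simp

end ADivisor

open scoped Classical in
/-- `deg_F(𝔞_E) = Σ_{v ∈ E} c_v·deg_F(v)`. [cite: Mochizuki2012, IUTchIV Def. 1.9 (ii) p. 22] -/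
theorem degF_restrictTo (E : Finset (Place F)) (a : ADivisor F) :
    degF F (a.restrictTo E) = ∑ v ∈ E, a v * degWeight F v := by
  rw [degF_apply, Finsupp.sum]
  have hsub : (a.restrictTo E).support ⊆ E := fun v hv => by
    rw [Finsupp.mem_support_iff, ADivisor.restrictTo_apply] at hv
    by_contra h
    exact hv (if_neg h)
  rw [Finset.sum_subset hsub (fun v _ hv => by
    rw [Finsupp.notMem_support_iff.mp hv, zero_mul])]
  refine Finset.sum_congr rfl fun v hv => ?_
  rw [ADivisor.restrictTo_apply, if_pos hv]

/-- **The normalized `E`-degree** `deg_E(𝔞) := deg_F(𝔞_E) / Σ_{v ∈ E} [F_v : ℚ_{v_ℚ}]` (for a nonempty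
finite set `E` of places over one `v_ℚ`; the definition makes sense for any finite `E`).
[cite: Mochizuki2012, IUTchIV Def. 1.9 (ii) p. 22] -/
def degE (E : Finset (Place F)) (a : ADivisor F) : ℝ :=
  degF F (a.restrictTo E) / ∑ v ∈ E, (placeDegree F v : ℝ)

/-- The denominator `Σ_{v∈E} [F_v : ℚ_{v_ℚ}]` is positive for nonempty `E`.
[cite: Mochizuki2012, IUTchIV Def. 1.9 (ii) p. 22] -/
theorem sum_placeDegree_pos {E : Finset (Place F)} (hE : E.Nonempty) :
    0 < ∑ v ∈ E, (placeDegree F v : ℝ) :=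
  Finset.sum_pos (fun v _ => by exact_mod_cast placeDegree_pos F v) hE

/-- `deg_E` is additive in `𝔞`. [cite: Mochizuki2012, IUTchIV Def. 1.9 (ii) p. 22] -/
theorem degE_add (E : Finset (Place F)) (a b : ADivisor F) :
    degE F E (a + b) = degE F E a + degE F E b := by
  simp [degE, ADivisor.restrictTo_add, map_add, add_div]

/-- `deg_E` of an effective divisor is nonnegative. [cite: Mochizuki2012, IUTchIV Def. 1.9 (ii) p. 22] -/
theorem degE_nonneg (E : Finset (Place F)) {a : ADivisor F} (ha : a.IsEffective) : 0 ≤ degE F E a := by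
  refine div_nonneg ?_ (Finset.sum_nonneg fun v _ => Nat.cast_nonneg _)
  rw [degF_restrictTo]
  exact Finset.sum_nonneg fun v _ => mul_nonneg (ha v) (degWeight_pos F v).le

/-- **`deg_E = deg` when `E` is the set of ALL archimedean places** (`v_ℚ = ∞`: `Σ_{v|∞}[F_v:ℝ] = [F:ℚ]`):
`deg_{𝕍(F)^arc}(𝔞) = deg(𝔞_{𝕍(F)^arc})`. [cite: Mochizuki2012, IUTchIV Def. 1.9 (ii) p. 22] -/
theorem degE_placesOverInf_eq_ndeg (a : ADivisor F) :
    degE F ((Finset.univ : Finset (InfinitePlace F)).map ⟨Sum.inl, Sum.inl_injective⟩) a =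
      ndeg F (a.restrictTo ((Finset.univ : Finset (InfinitePlace F)).map ⟨Sum.inl, Sum.inl_injective⟩)) := by
  rw [degE, ndeg_apply, Finset.sum_map]
  congr 1
  change ∑ v : InfinitePlace F, (placeDegree F (Sum.inl v) : ℝ) = _
  exact_mod_cast sum_placeDegree_inl F

/-- **`deg_E = deg` when `E` is the set of ALL places over a prime `p`** (`Σ_{v|p}[F_v:ℚ_p] = [F:ℚ]`):
`deg_{𝕍(F)_p}(𝔞) = deg(𝔞_{𝕍(F)_p})`. [cite: Mochizuki2012, IUTchIV Def. 1.9 (ii) p. 22] -/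
theorem degE_placesOver_eq_ndeg (p : ℕ) [Fact p.Prime] (a : ADivisor F) :
    degE F ((placesOver F p).map ⟨Sum.inr, Sum.inr_injective⟩) a =
      ndeg F (a.restrictTo ((placesOver F p).map ⟨Sum.inr, Sum.inr_injective⟩)) := by
  rw [degE, ndeg_apply, Finset.sum_map]
  congr 1
  change ∑ v ∈ placesOver F p, (placeDegree F (Sum.inr v) : ℝ) = _
  exact_mod_cast sum_placeDegree_inr F p

end Literature.IUT.LogVolume
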